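import Mathlib
import HarnessLib
import HarnessLib.Audit
import Summits.NavierStokesRegularity.Statement
import Literature.Analysis.FluidPDE.VasseurBackwardLevelSetRecurrence
import Literature.Analysis.FluidPDE.ClassicalSolution
import Literature.Analysis.FluidPDE.LerayHopf
import Literature.Analysis.FluidPDE.VectorCalculus
import Literature.Analysis.FluidPDE.NSWave0

/-!
Route: DeGiorgiThreeHalves

CLOSED (superseded) 2026-08-17T10:52:49Z by planner-rrepair-NavierStokesRegularity-DeGiorg-73633f9f-g3-0 — reason: superseded:route-NavierStokesRegularity-LevelSetModeration — superseded by route-NavierStokesRegularity-LevelSetModeration — note: route-repair gen 3 (badge/BC6), payload option (c): CLOSED superseded by route-NavierStokesRegularity-LevelSetModeration. CENSUS. (1) The stamped defect is STALE: payload.bc6 is the birth computation (08:57:32Z: unaccounted CascadeBeyondOne, Assembly); gen 1 dropped CascadeBeyondOne (rev 3), gen 2 w. The file is kept as the record of this route; refuted decls are indexed as negative knowledge (`ledger negatives`).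

# Route DeGiorgiThreeHalves — De Giorgi at three halves — Vasseur's level-set cascade closes Clay
(A) once the local-pressure pairing gains past 3/2

NEAR-MISS HARVEST (lens 3.15), CONDITIONAL BRIDGE on Vasseur 2007, Conjecture 14 (NoDEA 14,
Appendix) in BACKWARD SMOOTH form, stated over the
ACCEPTED predicate `Literature.Analysis.FluidPDE.Vasseur2007.BackwardLevelSetRecurrence p C β`
(p138992, landed for this route): for 0 < ε ≤ 1, every
classical solution (w,q) of NS (ν=1, f=0) on S ⊇ [−1,0], u = ε•w, IF U₀⁻[u] ≤ 1 THEN for k ≥ 1, U_k⁻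
≤ (C^k/ε)(1+‖ε²q‖_(L^p(−1,0;L¹(B₁)))) (U_(k−1)⁻)^β,
U_k⁻ = levelEnergyUntil 0 u k on backward cylinders [T_k,0]×B_k (Vasseur §2 radii/levels;
Vasseur–Yang 2021 §5 orientation). Level form: L = 1/ε.
X = `LevelSetCascade` := ∃ p > 1, ∃ C > 0, ∃ β > 3/2, BackwardLevelSetRecurrence p C β (exactly the
conjecture-leaf text the literature-prover certified).
It suffices to show X: Vasseur's Appendix (re-derived in DEFICIT.md §1 L5–L6, backward) turns X into
an a-priori sup bound for classical Leray–Hopf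
solutions, and the tree's `hasSmoothExtensionPast_of_bounded_holds` +
`navierStokesRegularity_of_noBlowup` give Clay (A). The single improved input
(crux #1 `LocalPressurePairing`) is the exponent of the ONE term of the cascade below 3/2 in print:
the local pressure paired with the streamwise
growth of speed on the superlevel set, proved at 4/3⁻ (2007) and 4/3 (2021), needed > 3/2.
Lean: `∃ p : ℝ, 1 < p ∧ ∃ C : ℝ, 0 < C ∧ ∃ β : ℝ, 3 / 2 < β ∧
Literature.Analysis.FluidPDE.Vasseur2007.BackwardLevelSetRecurrence p C β`

## Assembly
Pure logic, cone-clean since the cone repair of 2026-08-17 (certified glue.lean, lean check rc 0,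
standard axioms; the route
file imports definition modules only): closes (h₁ : LocalPressurePairing) (h₂ : CascadeOfPairing)
(h₃ : CascadeBoundsSpeed)
(h₄ : BoundedToClay) := h₄ (h₃ (h₂ h₁)) — the pairing bound gives the cascade X (h₂), Vasseur's
Appendix turns X into an a-priori
sup bound for every classical Leray–Hopf solution from a rapidly decaying datum (h₃), and the
support item BoundedToClay (bounded ⇒
Clay (A): continuation of bounded Leray–Hopf solutions, RobinsonRodrigoSadowski2016 Thm 8.17 =
`hasSmoothExtensionPast_of_bounded_holds`,
composed with the shared NoBlowup ⇒ (A) theorem `navierStokesRegularity_of_noBlowup`, stmt-0055 —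
both PROVED in tree, composite
kernel-checked in the planner's bc/BoundedToClay_provable.lean) turns that bound into Clay (A).
BoundedToClay is kept as an ITEM (its
hypothesis is CascadeBoundsSpeed's conclusion verbatim) so that this file no longer imports
Theorems.NoBlowupToClay / KNSSTypeIIHolds,
whose module closure carries 27 unproved rider facts none of which the route uses. One open crux is
load-bearing (conditional bridge
by design of the lens).

CONDITIONAL on Literature.Analysis.FluidPDE.Vasseur2007.BackwardLevelSetRecurrence — this route is an explicit reduction to that named conjecture (D-0019: crux floor waived).

Rationale: WHY THIS LINE. Vasseur's De Giorgi proof of Caffarelli–Kohn–Nirenberg (Vasseur2007, Prop. 3) pushes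
every term of the level-set energy
inequality ABOVE the scaling exponent 3/2 (transport and divergence-form pressure reach 5/3, the
non-local pressure
5/3(1−1/q) > 3/2 for q > 10) except one — the local pressure term not in divergence form, at 4/3 —
and his Appendix proves that
β > 3/2 for that term would make every finite-energy suitable solution bounded, hence regular;
Vasseur–Yang (VasseurYang2021,
arXiv:2009.14291 §5.1) re-measured the same 4/3 in a pressure-free formulation, localising it to the
trilinear self-interaction
T∇[α_k v, β_k v, β_k v]. DEFICIT.md re-derives the chain in level currency (the binding pairing
scales like L^(+1/3)U^(4/3) and
must scale like L^(−δ)), shows 4/3 is the dimensional ceiling of Hölder–Chebyshev–Calderón–Zygmund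
and identifies what structure
is left to use: moderator invariance (TranYu2016: pressure determined up to 𝒫 = f·g(|u|), ∂_ξ f =
0), the exact cancellation
of the kinetic half −|u|²/2 of the Bernoulli split, and the identity |u| div ξ = −ξ·∇|u|
(Vasseur2009): the deficit sits in
the LOCAL LAMB HEAD paired with streamwise speed growth, which vanishes for Beltrami slices.
Imported areas: elliptic/parabolic
De Giorgi–Nash–Moser regularity (the precedent where De Giorgi closed a critical drift:
CaffarelliVasseur2010, SQG), turbulence
phenomenology (Beltramisation / depression of nonlinearity, pressure moderation). No route of the 71
on this summit uses level-set
truncation of |u| (grep De Giorgi/Vasseur/level set/truncation: prose mentions only); the nearest,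
BernoulliDeceleration, needs a
one-sided bound on the head itself (Seregin–Šverák), this line needs only a U^(1/6) gain of one
localised pairing inside a
cascade all of whose other links are theorems.

RANKED CRUXES. #0 LevelSetCascade (target) — X above — Vasseur's Conjecture 14 in backward smooth
form: ∃ p > 1, C > 0, β > 3/2 with `Vasseur2007.BackwardLevelSetRecurrence p C β` (the accepted
predicate: ε-normalised classical solutions u = ε•w on [−1,0]×ℝ³, U₀⁻ ≤ 1, steps k ≥ 1). (why it
might fail: Conj. 14 is FALSE on the Navier–Stokes-INEQUALITY class (Prop. 3 and the Appendix are
NSI-valid with the good sign, Scheffer's NSI fields are singular): any truth must come from f = 0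
used dynamically; Vasseur himself: "at most a curiosity … highly controversial".) [Vasseur2007,
VasseurYang2021, Ozanski2019NSI, Scheffer1985]
#2 LocalPressurePairing (crux) — the binding input at v₁ = 3/2, in the SAME normalisation as the
accepted predicate: for some β ∈ (3/2, 14/9] and C > 0, for every 0 < ε ≤ 1, every classical NS
solution (w,q) (ν=1) on S ⊇ [−1,0] with u := ε•w and U₀⁻[u] ≤ 1, every k ≥ 1, every admissible pair
of cutoffs (φ between B_(k−2/3) and B_(k−1), η between B_k and B_(k−1/3), derivative budget
1024·2^3k / 1024·2^6k) and every local pressure P₂ of u (−ΔP₂ = Σ∂ᵢ∂ⱼ(φ uᵢuⱼ) on ℝ³, P₂ → 0 at ∞):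
the non-divergence local-pressure pairing ∫_(T_(k−1))^0 ∫ η P₂ div(ξ v_k) — with div(ξ v_k) = c_k
(D|u|·u)/|u|² on {|u| > c_k}, c_k = Vasseur2007.level k — is at most C^k (U_(k−1)⁻[u])^β in absolute
value (printed value: C^k U^(4/3)/ε^0 … i.e. level law L^(1/3)U^(4/3); 14/9 = 5/3(1−1/15) is the
WLOG cap serving p = 15 in the non-local term). [difficulty: open-problem] (why it might fail: 4/3
is the Hölder ceiling on the information (bounded below-level part × energy-class excess × Chebyshev
support), attained by a marginal bump with O(1) streamline bending; and no KINEMATIC proof can exist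
(NSI calibration): the gain must be dynamical, which nobody has extracted since 2007.) [Vasseur2007,
VasseurYang2021, Vasseur2009, TranYu2016, SereginSverak2002, CaffarelliVasseur2010, Ozanski2019NSI]
#9 CascadeOfPairing (support) — Vasseur 2007 Steps 3–5 re-run BACKWARD for classical solutions in
pairing form (19)–(20) with pressure exponent p = 15: cutoff, transport, non-local pressure
(exponent 14/9) and the divergence part of the local pressure all obey the recurrence with exponent
≥ β for β ≤ 14/9 (absorbed through U_(k−1)⁻ ≤ U₀⁻ ≤ 1), so the pairing bound yields
`BackwardLevelSetRecurrence 15 C β` (DEFICIT.md §1 L1–L3d). [difficulty: L] [Vasseur2007, Lin1998,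
CaffarelliKohnNirenberg1982]
#9 CascadeBoundsSpeed (support) — Vasseur 2007 Appendix re-run (DEFICIT.md §1 L4–L6): viscosity
scaling to ν = 1; at each (t₀,x₀) with t₀ ≥ t₁ BACKWARD parabolic rescaling (cylinder [t₀−λ²,
t₀]×B(x₀,λ) ⊂ (0,T)×ℝ³, λ² = t₁/2) to the slab [−1,0]×ℝ³; Riesz-gauge pressure in L^q_loc(L¹_loc)
uniformly in x₀; Lemma 4; choose ε = ε(E/λ, β, C, p) (= 1/L); conclude |u| ≤ 1/(ελ) on [t₁,T)×ℝ³;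
local theory (Kato/Tao) on [0,t₁] — an a-priori sup bound for classical Leray–Hopf solutions from
rapidly decaying data. [difficulty: L] [Vasseur2007, LemarieRieusset2016,
CaffarelliKohnNirenberg1982]
#9 CascadeBeyondOne (DROPPED from the items in the cone repair 2026-08-17: a tripwire / in-kind
special case outside the cone of `closes` (BC6 unaccounted; the `aside` re-kind crashed the gate
renderer); Lean statement kept here for refuters and for a tenure re-filing as support: `∃ p : ℝ, 1
< p ∧ ∃ C : ℝ, 0 < C ∧ ∃ β : ℝ, 1 < β ∧
Literature.Analysis.FluidPDE.Vasseur2007.BackwardLevelSetRecurrence p C β`) — the v₀ side, IN PRINT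
(Vasseur 2007 Prop. 3 + the scaling remark p. 29, backward orientation as in Vasseur–Yang 2021 §5):
`BackwardLevelSetRecurrence p C β` holds for SOME p > 1, C > 0 and SOME exponent β > 1 (any β below
the printed 4/3⁻); a misstatement tripwire for the accepted predicate and an in-kind special case
for provers. [difficulty: XL] [Vasseur2007]
#9 BoundedToClay (support, added by the cone repair 2026-08-17) — BOUNDED ⇒ CLAY (A): if every
classical solution of unforced NS on ℝ³×[0,T) that is Leray–Hopf on [0,T] from a rapidly decaying
datum is bounded on [0,T)×ℝ³ (all ν, T > 0; hypothesis written exactly as the conclusion of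
CascadeBoundsSpeed), then Fefferman's (A) holds. PROVABLE NOW: `fun h =>
navierStokesRegularity_of_noBlowup (fun _ _ hν hT _ _ hcl hLH hdec =>
hasSmoothExtensionPast_of_bounded_holds hν hT hcl hLH (h hν hT hcl hLH hdec))`
(bc/BoundedToClay_provable.lean, rc 0, axioms propext/Classical.choice/Quot.sound). The Assembly
item is restated in the same revision to mirror the certified `closes` (LocalPressurePairing →
CascadeOfPairing → CascadeBoundsSpeed → BoundedToClay → NavierStokesRegularity; provable by `fun h₁
h₂ h₃ h₄ => closes h₁ h₂ h₃ h₄`, pure logic). [difficulty: provable-now]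
[RobinsonRodrigoSadowski2016, LemarieRieusset2016, Fefferman2000]

TWO-LAYER PLAN. Foreseen once attacked (nothing filed now): LocalPressurePairing ⇐ HeadReduction →
HeadGain → LocalPressurePairing (bc/LocalPressurePairing_birth.lean,
kernel-checked): HeadReduction = "pairing with P_k2 − H_k (kinetic moderator −φ|u|²/2 plus two
annulus potentials with L^∞_t L¹_x sources)
has exponent 5/3" (provable, M/L); HeadGain = "the LOCAL LAMB HEAD pairing c_k ∫∫_(Ω_k) η_k H_k ∂_ξ
log|u|, ΔH_k = div(φ_k u×ω), gains
past 3/2" (the research node). A second foreseen split of HeadGain by regime: Beltrami-aligned part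
(|u×ω| ≤ θ|u||ω|) vs. transversal part.

KILL CRITERIA. (1) A family of classical NS solutions (explicit or certified numerics) on which the
pairing's level law has exponent ≤ 3/2 at high
levels refutes LocalPressurePairing ⇒ close `refuted:LocalPressurePairing` unless the measured
failure is confined to the cap/cutoff
constants (then restate). (2) A refutation of the dropped tripwire CascadeBeyondOne (statement under
RANKED CRUXES) would mean the level form mis-transcribes Prop. 3 ⇒ repair by
re-typing U_k (misstated class) in LevelSetCascade / LocalPressurePairing. (3) A proof that Conj. 14
fails for some smooth NS solution (not NSI) kills the bridge outright. (4) If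
another route proves NoBlowup, this route is moot (superseded).

NOT DECOMPOSED YET. The Lamb-head split (Two-layer plan) is recorded in bc/ but not filed; the
dynamic ingredient (how f = 0 enters beyond the energy
inequality — vorticity transport of u×ω, Vasseur–Yang parabolic bootstrap at scale U^(1/3)) is
deliberately not typed until a
crux-ideation pass; the negative companion "cascade with β > 3/2 FAILS on the NSI class" (a
`_false_without_equation` lemma from the
tree's NavierStokesInequalitySingularSolutions + the NSI-valid Appendix) is left to the disprover
seat; constants (1024, 14/9, q = 15) are
WLOG and not to be optimised.

CHEAPEST FALSIFIER. Compute U_k(L) and the pairing for explicit smooth solutions at levels L ∈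
{2,4,8,16}, k ≤ 6: (a) decaying ABC/Beltrami flow — the
pairing must vanish identically (Lamb head ≡ 0; checks the definitions); (b) a Lamb–Oseen /
Burgers-type vortex tube in a uniform
stream tuned so that |u| exceeds the level marginally on a thin tube (the Hölder-extremal geometry
of DEFICIT.md §2(c)) — fit the
exponent of U_k in the bound for step k+1 and the power of L; (c) calibration on an Ożański–Scheffer
NSI block, where the exponent MUST come out ≤ 3/2.
One kit job (quadrature on a space–time grid); not run this cycle (planner seat, no numerics budget
requested).

NUMBERS. β₀ = 4/3⁻ (Vasseur2007 p.5, p.24: G₂₂₂ ⅚+½, G₂₂₃/G₂₃₂ ⅓+1, P_k21 4/3−5/(3q)); β₀ = 4/3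
again pressure-free (VasseurYang2021 §5.1:
‖∇(β_k v)‖₂·U^(5/6)); β₁ > 3/2 strict (Appendix (32): (2β−3)/(β−1) > 0); other links 5/3, 5/3(1−1/q)
(> 3/2 iff q > 10; q = 15 gives
14/9); level law L^(γ+2−2β), closing iff 2(β−1) > γ, now (4/3,1); Hölder ceiling 4/3 (DEFICIT.md
§2(c)); Vasseur2009 conditional
class for the same scalar: div ξ ∈ L^p_t L^q_x, 2/p+3/q ≤ 1/2; a-priori class of ∂_ξ|u|·1_(|u|>λ):
L²_(t,x). Items: 6 at open; after the cone repair (2026-08-17) 6 = target LevelSetCascade, crux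
LocalPressurePairing, supports CascadeOfPairing / CascadeBoundsSpeed / BoundedToClay, Assembly
restated to mirror `closes` (CascadeBeyondOne dropped, see RANKED CRUXES).
CONE HYGIENE (for provers; priority guardrail `blocked-by-cone`): at open the file imported
Literature.Analysis.FluidPDE.KNSSTypeIIHolds and Summits…Theorems.NoBlowupToClay for the two landed
theorems the old `closes` used; their module closure (745 project modules) carries 27 unproved NAMED
FACTS (priority census; e.g. the deprecated, mis-stated
`Literature.Analysis.FluidPDE.albritton_singular_point_of_blowup`, reached via NoBlowupToClay →
NSCriticalClosureBesovKatoClass → AlbrittonBlowupCriterionKato → AlbrittonBlowupCriterion, which can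
never be discharged) — NONE of them in the constant cone of `closes` (gate: 0 unproved among 41
constants). Since the cone repair the file imports only VasseurBackwardLevelSetRecurrence,
ClassicalSolution, LerayHopf, VectorCalculus, NSWave0 (module closure 21 project modules; every
named fact in it has a `_holds` discharge in a Proofs module; the three @[conjecture] Clay (B)–(D)
leaves of NSWave0 ride with the Statement itself). A Theorems file proving an item of this route
states it against THIS route's decl (`theorem … : …Theses.DeGiorgiThreeHalves.<Decl>`, importing
this file — then the gate cannot back-link it and the heavy imports of the proof stay out of this
file); do NOT close BoundedToClay `--by` a route-independent or cross-route theorem (e.g.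
Theorems.LevelSetModerationBoundedToClay / NoBlowupToClay): the gate's `_holds` link would import
that module here and re-block the route. needs-fact: none.

DEFINITION REQUESTS. None filed: U_k, the cutoffs, the local pressure and the pairing are inlined
(`let`) in the item statements over existing declarations
(`Literature.Analysis.FluidPDE.IsClassicalNSSolutionOn`, `frobeniusNormSq`, `gradient`, `fderiv`,
`iteratedFDeriv`, `Laplacian.laplacian`,
lintegral/Bochner integrals); a tenure pass may promote them to `Theorems/DeGiorgiCascade.lean`
definitions (`--kind definition --topic
Summits/NavierStokesRegularity/NavierStokesRegularity/Theorems`) once a prover asks.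

Novelty: Searches (2026-08-17): `lit search --hybrid "De Giorgi level set truncation Navier-Stokes full
regularity exponent 3/2 pressure"` (12 docs, books only:
Lemarié-Rieusset 2016 p.460 cites Vasseur [487] as "à la Di Giorgi", no exponent discussion); `lit
galaxy search --star all "new proof of partial
regularity of solutions to Navier-Stokes"` (7 rows: Ożański CKN lecture notes, Bjorland–Vasseur,
Mellet–Vasseur — no improvement of 4/3);
`lit search ... --source crossref` (Vasseur2007 cit=98, Vasseur2009 cit=45); `lit read` of
Vasseur2007 (pp.1–31), arXiv:2009.14291 (§4–5),
arXiv:0705.2446, Tran–Yu 2018 (LMS LN 452 ch. 9, pp.209–222); tree: `ledger negatives` (4, none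
related), grep of 71 Theses + 20 Ideas for
De Giorgi/Vasseur/level set/truncation (prose mentions in BernoulliDeceleration, SlicedKelvin only);
questions.tsv (F7 fang-chen-zhang only).
Nearest prior art found: Vasseur2007 Conj. 14 + Appendix (the bridge itself, known); VasseurYang2021
§5.1 (same exponent, pressure-free);
Vasseur2009 (conditional form of the same scalar ∂_ξ|u|); TranYu2016 (moderators); in tree: route
BernoulliDeceleration (head with a SIGN).
Delta: the printed near-miss re-typed as ONE level-law inequality for ONE explicit pairing (kinetic
half cancelled exactly, deficit
localised to the Lamb head × streamwise growth, L^(+1/3) → L^(−δ)), with the NSI calibration showing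
the gain must be dynamical —
none of which is in print; as a ROUTE it is a conditional bridge on a known conjecture.
Claimed grade: n  [refs: 2009.14291, 0705.2446, Vasseur2007, Vasseur2009, VasseurYang2021, TranYu2016]

Barriers (technique_class: de-giorgi-iteration, level-set-truncation, eps-reg): - technique_class: de-giorgi-iteration, level-set-truncation, epsilon-regularity,
local-pressure-decomposition
- Literature.Barriers.NavierStokesRegularity.NavierStokesInequalitySingularSolution: evaded BY
HYPOTHESIS and it BITES ON PROOFS — the crux quantifies over classical solutions of the EQUATION (f
= 0); Prop. 3 and the Appendix are NSI-valid with the good sign (f·u ≤ 0 gives (11) with ≤), so on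
Scheffer–Ożański fields the cascade holds below 4/3 and MUST fail above 3/2: no kinematic inequality
over divergence-free fields can prove LocalPressurePairing; the bet is a dynamical use of f = 0
(Lamb-vector transport / parabolic bootstrap at scale U^(1/3)), exactly the evasion the catalogue
names ("Vasseur (De Giorgi iteration) … use the equation").
- Literature.Barriers.NavierStokesRegularity.TaoAveragedBlowup: evaded — the truncation identities
(12), (19) (u·∂u contracted with u·g(|u|) is a derivative; div(ξ v_k) = c_k ∂_ξ log|u|) and the
local energy EQUALITY are pointwise properties of the true bilinear form B(u,u) = P div(u⊗u) not
shared by Fourier-averaged B̃ (no local energy inequality, no level sets of |u| transported); the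
missing U^(1/6) is likewise bet on B's fine structure (Lamb head), which is what Tao's barrier
demands.
- Literature.Barriers.NavierStokesRegularity.EnergySupercriticality: it does not evade at the
binding term — (β,γ) = (4/3,1) is exactly the supercritical count 2(β−1) < γ, while every other link
overtakes the scale by Chebyshev (Vasseur p.18); th

History (route lifecycle, newest last):
- 2026-08-17T09:36:45Z · rev 3: restated Assembly (stmt-NavierStokesRegularity-18005) — cone repair (route-repair planner, 2026-08-17): dropped imports KNSSTypeIIHolds + Theorems.NoBlowupToClay (module closure 745 → 21 project modules; 27 unproved (planner-rrepair-NavierStokesRegularity-DeGiorg-73633f9f-0)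
- 2026-08-17T09:39:19Z · rev 3: dropped CascadeBeyondOne — drop CascadeBeyondOne: tripwire/special-case item outside the cone of closes (BC6 unaccounted); its re-kind to aside crashed the gate renderer (KeyError: 'aside (planner-rrepair-NavierStokesRegularity-DeGiorg-73633f9f-0)
- 2026-08-17T10:52:49Z · CLOSED superseded — superseded:route-NavierStokesRegularity-LevelSetModeration (planner-rrepair-NavierStokesRegularity-DeGiorg-73633f9f-g3-0)

sub-problem: NavierStokesRegularity · status: closed(superseded) · opened planner-plan-lens3-NavierStokesRegularity-nearmiss-0 2026-08-17T08:42:06Z · rev 5 · ledger route-NavierStokesRegularity-DeGiorgiThreeHalves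
GENERATED by the gate from the ledger (D-0016/17). Provers cite these decls: `theorem foo : Summit.NavierStokesRegularity.NavierStokesRegularity.Theses.DeGiorgiThreeHalves.<Decl> := …` in Summits/NavierStokesRegularity/NavierStokesRegularity/Theorems/<Name>.lean.
-/

namespace Summit.NavierStokesRegularity.NavierStokesRegularity.Theses.DeGiorgiThreeHalves

open scoped BigOperators Topology Manifold Classical MeasureTheory ProbabilityTheory Matrix InnerProductSpace ComplexConjugate ContinuousMap
open Filter Set Function TopologicalSpace MeasureTheory

attribute [summit_statement] _root_.NavierStokesRegularity

open Literature.NS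

/-- item stmt-NavierStokesRegularity-18000 · target · rank 0 · closed · moot by None · by planner
why it might fail: Conj. 14 is FALSE on the Navier–Stokes-INEQUALITY class (Prop. 3 and the Appendix are NSI-valid with the good sign, Scheffer's NSI fields are singular): any truth must come from f = 0 used dynamically; Vasseur himself: "at most a curiosity … highly controversial".
sources: Vasseur2007, VasseurYang2021, Ozanski2019NSI, Scheffer1985
[target] X above — Vasseur's Conjecture 14 in backward smooth form: ∃ p > 1, C > 0, β > 3/2 with
`Vasseur2007.BackwardLevelSetRecurrence p C β` (the accepted predicate: ε-normalised classical
solutions u = ε•w on [−1,0]×ℝ³, U₀⁻ ≤ 1, steps k ≥ 1). -/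
@[route_item "route-NavierStokesRegularity-DeGiorgiThreeHalves"]
def LevelSetCascade : Prop :=
  ∃ p : ℝ, 1 < p ∧ ∃ C : ℝ, 0 < C ∧ ∃ β : ℝ, 3 / 2 < β ∧ Literature.Analysis.FluidPDE.Vasseur2007.BackwardLevelSetRecurrence p C β

/-- item stmt-NavierStokesRegularity-18001 · crux · rank 2 · closed · moot by None · by planner
why it might fail: 4/3 is the Hölder ceiling on the information (bounded below-level part × energy-class excess × Chebyshev support), attained by a marginal bump with O(1) streamline bending; and no KINEMATIC proof can exist (NSI calibration): the gain must be dynamical, which nobody has extracted since 2007.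
sources: Vasseur2007, VasseurYang2021, Vasseur2009, TranYu2016, SereginSverak2002, CaffarelliVasseur2010
[crux] the binding input at v₁ = 3/2, in the SAME normalisation as the accepted predicate: for some
β ∈ (3/2, 14/9] and C > 0, for every 0 < ε ≤ 1, every classical NS solution (w,q) (ν=1) on S ⊇
[−1,0] with u := ε•w and U₀⁻[u] ≤ 1, every k ≥ 1, every admissible pair of cutoffs (φ between
B_(k−2/3) and B_(k−1), η between B_k and B_(k−1/3), derivative budget 1024·2^3k / 1024·2^6k) and
every local pressure P₂ of u (−ΔP₂ = Σ∂ᵢ∂ⱼ(φ uᵢuⱼ) on ℝ³, P₂ → 0 at ∞): the non-divergence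
local-pressure pairing ∫_(T_(k−1))^0 ∫ η P₂ div(ξ v_k) — with div(ξ v_k) = c_k (D|u|·u)/|u|² on {|u|
> c_k}, c_k = Vasseur2007.level k — is at most C^k (U_(k−1)⁻[u])^β in absolute value (printed value:
C^k U^(4/3)/ε^0 … i.e. level law L^(1/3)U^(4/3); 14/9 = 5/3(1−1/15) is the WLOG cap serving p = 15
in the non-local term). [difficulty: open-problem] -/
@[route_item "route-NavierStokesRegularity-DeGiorgiThreeHalves"]
def LocalPressurePairing : Prop :=
  ∃ β : ℝ, 3 / 2 < β ∧ β ≤ 14 / 9 ∧ ∃ C : ℝ, 0 < C ∧ ∀ ε : ℝ, 0 < ε → ε ≤ 1 → ∀ (S : Set ℝ) (w : ℝ → EuclideanSpace ℝ (Fin 3) → EuclideanSpace ℝ (Fin 3)) (q : ℝ → EuclideanSpace ℝ (Fin 3) → ℝ), Set.Icc (-1 : ℝ) 0 ⊆ S → Literature.Analysis.FluidPDE.IsClassicalNSSolutionOn S 1 0 w q → let u : ℝ → EuclideanSpace ℝ (Fin 3) → EuclideanSpace ℝ (Fin 3) := fun t x => ε • w t x; Literature.Analysis.FluidPDE.Vasseur2007.levelEnergyUntil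 0 u 0 ≤ 1 → ∀ k : ℕ, 1 ≤ k → ∀ (φ η : EuclideanSpace ℝ (Fin 3) → ℝ) (P₂ : ℝ → EuclideanSpace ℝ (Fin 3) → ℝ), let cut : ℝ → ℝ → (EuclideanSpace ℝ (Fin 3) → ℝ) → Prop := fun r R ψ => ContDiff ℝ (⊤ : ℕ∞) ψ ∧ (∀ x ∈ Metric.ball (0 : EuclideanSpace ℝ (Fin 3)) r, ψ x = 1) ∧ (∀ x, x ∉ Metric.ball (0 : EuclideanSpace ℝ (Fin 3)) R → ψ x = 0) ∧ (∀ x, 0 ≤ ψ x ∧ ψ x ≤ 1) ∧ (∀ x, ‖fderiv ℝ ψ x‖ ≤ 1024 * 2 ^ (3 * k)) ∧ (∀ x, ‖iteratedFDeriv ℝ 2 ψ x‖ ≤ 1024 * 2 ^ (6 * k)); cut ((1 + 4 * (2 : ℝ)⁻¹ ^ (3 * k)) / 2) (Literature.Analysis.FluidPDE.Vasseur2007.radius (k - 1)) φ → cut (Literature.Analysis.FluidPDE.Vasseur2007.radius k) ((1 + 2 * (2 : ℝ)⁻¹ ^ (3 * k)) / 2) η → (∀ t ∈ Set.Icc (-1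 : ℝ) 0, ContDiff ℝ (⊤ : ℕ∞) (P₂ t) ∧ (∀ x, Laplacian.laplacian (P₂ t) x = -(∑ i : Fin 3, ∑ j : Fin 3, iteratedFDeriv ℝ 2 (fun y => φ y * (u t y) i * (u t y) j) x ![EuclideanSpace.single i 1, EuclideanSpace.single j 1])) ∧ Filter.Tendsto (P₂ t) (Filter.cocompact (EuclideanSpace ℝ (Fin 3))) (nhds 0)) → ENNReal.ofReal |∫ t in Set.Icc (Literature.Analysis.FluidPDE.Vasseur2007.startTime (k - 1)) 0, ∫ x, η x * P₂ t x * (if Literature.Analysis.FluidPDE.Vasseur2007.level k < ‖u t x‖ then Literature.Analysis.FluidPDE.Vasseur2007.level k * (fderiv ℝ (fun y => ‖u t y‖) x (u t x)) / ‖u t x‖ ^ 2 else 0)| ≤ ENNReal.ofReal (C ^ k) * Literature.Analysis.FluidPDE.Vasseur2007.levelEnergyUntil 0 u (k - 1) ^ β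

/-- item stmt-NavierStokesRegularity-17984 · support · rank 9 · closed · moot by None · by planner
sources: RobinsonRodrigoSadowski2016, LemarieRieusset2016, Fefferman2000, Leray1934
[support] BOUNDED ⇒ CLAY (A) (cone repair 2026-08-17; replaces the direct use of two landed theorems
in `closes`): if every classical solution of the unforced Navier–Stokes system on ℝ³×[0,T) that is
Leray–Hopf on [0,T] from a rapidly decaying datum is bounded on [0,T)×ℝ³ (all ν, T > 0 — the
hypothesis is the conclusion of CascadeBoundsSpeed verbatim), then Fefferman's (A) holds:
continuation of bounded Leray–Hopf solutions (RobinsonRodrigoSadowski2016 Thm 8.17, Prodi–Serrin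
class L²_t L^∞_x; in tree `Literature.Analysis.FluidPDE.hasSmoothExtensionPast_of_bounded_holds`)
composed with the shared local Clay theory NoBlowup ⇒ (A) (stmt-NavierStokesRegularity-0055,
`navierStokesRegularity_of_noBlowup`, LemarieRieusset2016 Thm 15.1 (C) + Prop 12.3). PROVABLE NOW:
`fun h => navierStokesRegularity_of_noBlowup (fun _ _ hν hT _ _ hcl hLH hdec =>
hasSmoothExtensionPast_of_bounded_holds hν hT hcl hLH (h hν hT hcl hLH hdec))` (planner folder
bc/BoundedToClay_provable.lean, lean check rc 0, axioms propext/Classical.choice/Quot.sound). CONE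
HYGIENE: prove it in a Theorems file that imports THIS Theses file and states `theorem … :
…Theses.DeGiorgiThreeHalves.BoundedToClay` (as Theorems/LevelSetM -/
@[route_item "route-NavierStokesRegularity-DeGiorgiThreeHalves"]
def BoundedToClay : Prop :=
  (∀ ⦃ν T : ℝ⦄ ⦃u : ℝ → EuclideanSpace ℝ (Fin 3) → EuclideanSpace ℝ (Fin 3)⦄ ⦃p : ℝ → EuclideanSpace ℝ (Fin 3) → ℝ⦄, 0 < ν → 0 < T → Literature.Analysis.FluidPDE.IsClassicalNSSolutionOn (Set.Ico 0 T) ν 0 u p → Literature.Analysis.FluidPDE.IsLerayHopfOn T ν 0 (u 0) u → Literature.Analysis.FluidPDE.HasRapidSpatialDecay (u 0) → ∃ M : ℝ, ∀ t ∈ Set.Ico 0 T, ∀ x, ‖u t x‖ ≤ M) → _root_.NavierStokesRegularity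

/-- item stmt-NavierStokesRegularity-18002 · support · rank 9 · closed · moot by None · by planner
sources: Vasseur2007, Lin1998, CaffarelliKohnNirenberg1982
[support] Vasseur 2007 Steps 3–5 re-run BACKWARD for classical solutions in pairing form (19)–(20)
with pressure exponent p = 15: cutoff, transport, non-local pressure (exponent 14/9) and the
divergence part of the local pressure all obey the recurrence with exponent ≥ β for β ≤ 14/9
(absorbed through U_(k−1)⁻ ≤ U₀⁻ ≤ 1), so the pairing bound yields `BackwardLevelSetRecurrence 15 C
β` (DEFICIT.md §1 L1–L3d). [difficulty: L] -/
@[route_item "route-NavierStokesRegularity-DeGiorgiThreeHalves"]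
def CascadeOfPairing : Prop :=
  LocalPressurePairing → LevelSetCascade

/-- item stmt-NavierStokesRegularity-18003 · support · rank 9 · closed · moot by None · by planner
sources: Vasseur2007, LemarieRieusset2016, CaffarelliKohnNirenberg1982
[support] Vasseur 2007 Appendix re-run (DEFICIT.md §1 L4–L6): viscosity scaling to ν = 1; at each
(t₀,x₀) with t₀ ≥ t₁ BACKWARD parabolic rescaling (cylinder [t₀−λ², t₀]×B(x₀,λ) ⊂ (0,T)×ℝ³, λ² =
t₁/2) to the slab [−1,0]×ℝ³; Riesz-gauge pressure in L^q_loc(L¹_loc) uniformly in x₀; Lemma 4;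
choose ε = ε(E/λ, β, C, p) (= 1/L); conclude |u| ≤ 1/(ελ) on [t₁,T)×ℝ³; local theory (Kato/Tao) on
[0,t₁] — an a-priori sup bound for classical Leray–Hopf solutions from rapidly decaying data.
[difficulty: L] -/
@[route_item "route-NavierStokesRegularity-DeGiorgiThreeHalves"]
def CascadeBoundsSpeed : Prop :=
  LevelSetCascade → ∀ ⦃ν T : ℝ⦄ ⦃u : ℝ → EuclideanSpace ℝ (Fin 3) → EuclideanSpace ℝ (Fin 3)⦄ ⦃p : ℝ → EuclideanSpace ℝ (Fin 3) → ℝ⦄, 0 < ν → 0 < T → Literature.Analysis.FluidPDE.IsClassicalNSSolutionOn (Set.Ico 0 T) ν 0 u p → Literature.Analysis.FluidPDE.IsLerayHopfOn T ν 0 (u 0) u → Literature.Analysis.FluidPDE.HasRapidSpatialDecay (u 0) → ∃ M : ℝ, ∀ t ∈ Set.Ico 0 T, ∀ x, ‖u t x‖ ≤ M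

-- earlier Assembly (stmt-NavierStokesRegularity-18005, replaced 2026-08-17T09:36:45Z -> stmt-NavierStokesRegularity-17983): retired by None — LocalPressurePairing → CascadeOfPairing → CascadeBoundsSpeed → _root_.NavierStokesRegularity
/-- item stmt-NavierStokesRegularity-17983 · assembly · rank 1 · closed · moot by None · by planner
sources: Vasseur2007, Fefferman2000
[assembly] LocalPressurePairing → CascadeOfPairing → CascadeBoundsSpeed → BoundedToClay →
NavierStokesRegularity (mirrors the certified cone-clean `closes`; provable by `fun h₁ h₂ h₃ h₄ =>
closes h₁ h₂ h₃ h₄`, pure logic, no Theorems import needed beyond this file). -/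
@[route_item "route-NavierStokesRegularity-DeGiorgiThreeHalves"]
def Assembly : Prop :=
  LocalPressurePairing → CascadeOfPairing → CascadeBoundsSpeed → BoundedToClay → _root_.NavierStokesRegularity

end Summit.NavierStokesRegularity.NavierStokesRegularity.Theses.DeGiorgiThreeHalves
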